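import Summits.QuantumFields.BalabanUV.Beta.EriceFlowEnclosureCesaroTauberianSeq

/-!
# Beta / EriceFlowEnclosureCesaroClockSampling — THE TWO-LOOP CLOCK SAMPLES THE DATUM: ALONG CUTOFF COUPLINGS h_n WITH `n·h_n → L₀ > 0` A
# LOG-LIPSCHITZ FUNCTION M IS SLOWLY OSCILLATING IN n, `M(h_n) → m ⟺ M → m at 0⁺`, AND THEREFORE **AVERAGING A DEVIATION
# `d_n = c·(M(h_n) − m) + o(1)` OVER CUTOFFS n < N CANNOT CREATE ITS LIMIT: `N⁻¹·Σ_{n<N} d_n → 0 ⟺ d_n → 0 ⟺ M → m at 0⁺`**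
# (pure [folklore] SERVICE in the SHAPES rows L119 ∕ L120 deliver — the bare ∕ cutoff twin of row L130; imports P2 #53a only).
# (β-flow team, prover 2 = lower ∕ positivity side, unit `b2b-balaban-beta-bflow-p2`, gen 36; module P2 #53b; no Erice sentence occurs)

HONEST FRAMING (page 1 of everything the β sub-cell writes): discharging `BetaPertH` makes Bałaban's UV stability UNCONDITIONAL — a
real constructive-QFT result; it is NOT the continuum limit and NOT the Clay problem.  HONEST DEPENDENCY (cell reorg 2026-08-19,
verbatim): «continuum YM on T⁴ ⇐ BetaPertH ∧ nine spine estimates (0/9 proved); BetaPertH ⇐ (D1) ∧ (D4) ∧ CAP+tail; G-an2-4 gates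
asym, D1 and NE2/3/4.»  THIS MODULE DISCHARGES NOTHING and quotes nothing: [folklore] real analysis about a real function M, a positive
sequence h and a null sequence e.  WHERE THE SHAPES COME FROM (by name, not imported): M = the Cesàro mean `(1∕t)∫₀ᵗ r∕u²` of the three-loop
quotient, which is 2C₂-log-Lipschitz with NO hypothesis beyond |r∕u²| ≤ C₂ (P2 #52a `EriceFlowEnclosureCesaroHigherOrder.cesaro_logLip`);
h_K = the coupling after K steps of (3.62) from a fixed chart point, with the TWO-LOOP CLOCK `|K·h_K − 1∕|β₀|| ≤ 2B(1 + log K)∕(β₀²K)` (row L119,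
P2 `EriceFlowEnclosureLimitRunClockRate.clock_rate`), in particular `K·h_K → 1∕|β₀|`; d_K = the deviation of the BARE coupling sequence's 1∕K
letter of (3.76)'s O(1) term from a candidate letter b, which row L120 (`EriceFlowEnclosureLimitRunLetterRate.invK_rate_transfer`) identifies
as `(1∕β₀²)(M(h_K) − β₀²b) + O((1 + log K)²∕K)` — the shape `c·(M(h_K) − m) + e_K`, `e → 0`, `c = 1∕β₀² ≠ 0`.

THE POINT.  With x_n := n·h_n → L₀ > 0:  `log(h_i∕h_N) = (log x_i − log x_N) − log(i∕N)`, so on a window N ≤ i ≤ qN the log-ratio of the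
sampled points is at most `log q + o(1)` in absolute value and `|M(h_i) − M(h_N)| ≤ C·(log q + o(1))` — the sampled sequence is SLOWLY
OSCILLATING at ∞ with NO monotonicity of h assumed (§2).  Conversely every small t > 0 is clock-close to a sample: n := ⌈L₀∕t⌉ has
`n·t ∈ [L₀, L₀ + t]`, hence `h_n∕t = x_n∕(n t) ∈ [(1 − λ)∕(1 + λ), 1 + λ]` once `|x_n − L₀| ≤ λL₀` and `t ≤ λL₀`, and
`|M t − M(h_n)| ≤ C·log((1 + λ)∕(1 − λ)) ≤ 4Cλ` — so `M(h_n) → m` forces `M → m` at 0⁺ (§3).  §4 feeds the deviation `c·(M(h_n) − m) + e_n` to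
P2 #53a `cesaro_add_null_iff` (Schmidt's theorem for sequences).

WHAT THIS FILE PROVES (0 sorry, 0 def): §1 `logLip_abs`, `abs_log_le_of_bounds`, `log_ratio_le_four_mul`, `clock_pos`, `clock_tendsto_zero`,
`clock_nhdsWithin`; §2 HEADLINE **`sampled_slowlyOscillating`**; §3 `tendsto_sampled_of_tendsto`, HEADLINE **`tendsto_of_tendsto_sampled`**,
**`tendsto_sampled_iff`**; §4 `deviation_slowlyOscillating`, END **`cutoffAverage_iff`** (three equivalences: Cesàro over cutoffs ⟺ deviation ⟺
sampled datum ⟺ datum at 0⁺).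
NOT CLAIMED: the by-name junction with rows L119 ∕ L120 (their eventual-rate conclusions imply the `Tendsto` shapes used here — a successor
module); rates for the cutoff average (§1 of P2 #53a `logLip_rate` is the tool); anything about Bałaban's (1.22); `BetaPertH`; continuum; Clay.
-/

namespace Summit.QuantumFields.BalabanUV.Beta.EriceFlowEnclosureCesaroClockSampling

open Finset Filter Topology
open Summit.QuantumFields.BalabanUV.Beta.EriceFlowEnclosureCesaroTauberianSeq

noncomputable section

variable {M : ℝ → ℝ} {h e : ℕ → ℝ} {δ C L₀ : ℝ}

/-! ## §1 Service: the symmetric log-Lipschitz bound, log-ratio arithmetic, and the clock's elementary consequences -/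

/-- Symmetric form of the lineage's log-Lipschitz shape: `|M u − M t| ≤ C·|log(u∕t)|` for all t, u ∈ ]0, δ[. [folklore] -/
theorem logLip_abs (hlip : ∀ t u : ℝ, 0 < t → t ≤ u → u < δ → |M u - M t| ≤ C * Real.log (u / t))
    {t u : ℝ} (ht : 0 < t) (htδ : t < δ) (hu : 0 < u) (huδ : u < δ) :
    |M u - M t| ≤ C * |Real.log (u / t)| := by
  rcases le_total t u with htu | hut
  · have hlog : 0 ≤ Real.log (u / t) := Real.log_nonneg ((one_le_div ht).mpr htu)
    rw [abs_of_nonneg hlog]; exact hlip t u ht htu huδ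
  · have h := hlip u t hu hut htδ
    have hlog : 0 ≤ Real.log (t / u) := Real.log_nonneg ((one_le_div hu).mpr hut)
    have hinv : Real.log (u / t) = -Real.log (t / u) := by
      rw [← Real.log_inv, inv_div]
    rw [abs_sub_comm, hinv, abs_neg, abs_of_nonneg hlog]; exact h

/-- If `1∕ρ ≤ y ≤ ρ` with y > 0 (ρ ≥ 1) then `|log y| ≤ log ρ`. [folklore] -/
theorem abs_log_le_of_bounds {y ρ : ℝ} (hy : 0 < y) (hρ : 1 ≤ ρ) (hlo : ρ⁻¹ ≤ y) (hhi : y ≤ ρ) :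
    |Real.log y| ≤ Real.log ρ := by
  have hρ0 : 0 < ρ := by linarith
  rw [abs_le]; constructor
  · have := Real.log_le_log (inv_pos.mpr hρ0) hlo
    rwa [Real.log_inv] at this
  · exact Real.log_le_log hy hhi

/-- `log((1 + λ)∕(1 − λ)) ≤ 4λ` for `0 ≤ λ ≤ 1∕2` (from `log y ≤ y − 1`). [folklore] -/
theorem log_ratio_le_four_mul {l : ℝ} (hl0 : 0 ≤ l) (hl1 : l ≤ 1 / 2) :
    Real.log ((1 + l) / (1 - l)) ≤ 4 * l := by
  have h1l : 0 < 1 - l := by linarith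
  have hpos : 0 < (1 + l) / (1 - l) := div_pos (by linarith) h1l
  have hle : (1 + l) / (1 - l) - 1 ≤ 4 * l := by
    rw [div_sub_one h1l.ne', div_le_iff₀ h1l]; nlinarith
  exact (Real.log_le_sub_one_of_pos hpos).trans hle

/-- Along a positive sequence the clock products `x_n = n·h_n` are positive for n ≥ 1. [folklore] -/
theorem clock_pos (hpos : ∀ n, 0 < h n) {n : ℕ} (hn : 1 ≤ n) : 0 < (n : ℝ) * h n :=
  mul_pos (Nat.cast_pos.mpr (lt_of_lt_of_le Nat.one_pos hn)) (hpos n)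

/-- THE CLOCK FORCES h → 0: `n·h_n → L₀` ⟹ `h_n = (n·h_n)∕n → 0`. [folklore] -/
theorem clock_tendsto_zero (hclock : Tendsto (fun n : ℕ => (n : ℝ) * h n) atTop (𝓝 L₀)) :
    Tendsto h atTop (𝓝 0) := by
  have hinv : Tendsto (fun n : ℕ => ((n : ℝ))⁻¹) atTop (𝓝 0) := tendsto_inv_atTop_zero.comp tendsto_natCast_atTop_atTop
  have hprod := hclock.mul hinv
  rw [mul_zero] at hprod
  refine hprod.congr' ?_
  filter_upwards [eventually_ge_atTop 1] with n hn
  have hn' : (n : ℝ) ≠ 0 := Nat.cast_ne_zero.mpr (by omega)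
  field_simp

/-- … and, h being positive, `h_n → 0` WITHIN ]0, ∞[ (the filter the datum at 0⁺ is stated in). [folklore] -/
theorem clock_nhdsWithin (hpos : ∀ n, 0 < h n) (hclock : Tendsto (fun n : ℕ => (n : ℝ) * h n) atTop (𝓝 L₀)) :
    Tendsto h atTop (𝓝[>] 0) :=
  tendsto_nhdsWithin_iff.mpr ⟨clock_tendsto_zero hclock, Eventually.of_forall fun n => hpos n⟩

/-! ## §2 The sampled sequence n ↦ M(h_n) is slowly oscillating at ∞ -/

/-- **THE TWO-LOOP CLOCK MAKES THE SAMPLED CESÀRO MEAN SLOWLY OSCILLATING (HEADLINE).**  If `|M u − M t| ≤ C·log(u∕t)` for `0 < t ≤ u < δ`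
(C > 0, δ > 0), `h_n > 0` and `n·h_n → L₀ > 0`, then for every ε > 0 there are q > 1 and N₀ with **`|M(h_i) − M(h_N)| ≤ ε` whenever
`N₀ ≤ N ≤ i ≤ q·N`** (q = exp(ε∕(2C)); N₀ such that h_n < δ and `|log(n·h_n) − log L₀| < ε∕(4C)` beyond it) — NO monotonicity of h is used:
`log(h_i∕h_N) = (log(i·h_i) − log(N·h_N)) − log(i∕N)`. [folklore] -/
theorem sampled_slowlyOscillating (hC : 0 < C) (hδ : 0 < δ)
    (hlip : ∀ t u : ℝ, 0 < t → t ≤ u → u < δ → |M u - M t| ≤ C * Real.log (u / t))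
    (hpos : ∀ n, 0 < h n) (hL₀ : 0 < L₀) (hclock : Tendsto (fun n : ℕ => (n : ℝ) * h n) atTop (𝓝 L₀)) :
    ∀ ε > 0, ∃ q > (1:ℝ), ∃ N₀ : ℕ, ∀ N i : ℕ, N₀ ≤ N → N ≤ i → (i : ℝ) ≤ q * N →
      |M (h i) - M (h N)| ≤ ε := by
  intro ε hε
  -- the clock in logarithmic form: log(n h_n) → log L₀
  have hlogclock : Tendsto (fun n : ℕ => Real.log ((n : ℝ) * h n)) atTop (𝓝 (Real.log L₀)) :=
    ((Real.continuousAt_log hL₀.ne').tendsto).comp hclock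
  obtain ⟨N₁, hN₁⟩ := (Metric.tendsto_atTop.mp hlogclock) (ε / (4 * C)) (by positivity)
  obtain ⟨N₂, hN₂⟩ := eventually_atTop.mp ((clock_tendsto_zero hclock).eventually (gt_mem_nhds hδ))
  refine ⟨Real.exp (ε / (2 * C)), Real.one_lt_exp_iff.mpr (by positivity), max (max N₁ N₂) 1, fun N i h0 h1 h2 => ?_⟩
  have hN1 : N₁ ≤ N := le_trans (le_max_left _ _) (le_trans (le_max_left _ _) h0)
  have hN2 : N₂ ≤ N := le_trans (le_max_right _ _) (le_trans (le_max_left _ _) h0)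
  have hNone : 1 ≤ N := le_trans (le_max_right _ _) h0
  have hNpos : 0 < (N : ℝ) := Nat.cast_pos.mpr (lt_of_lt_of_le Nat.one_pos hNone)
  have hipos : 0 < (i : ℝ) := Nat.cast_pos.mpr (lt_of_lt_of_le Nat.one_pos (hNone.trans h1))
  have hxN : 0 < (N : ℝ) * h N := mul_pos hNpos (hpos N)
  have hxi : 0 < (i : ℝ) * h i := mul_pos hipos (hpos i)
  -- |log x_i − log x_N| < ε/(2C)
  have hdN := hN₁ N hN1
  have hdi := hN₁ i (hN1.trans h1)
  rw [Real.dist_eq] at hdN hdi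
  have hxx : |Real.log ((i : ℝ) * h i) - Real.log ((N : ℝ) * h N)| < ε / (2 * C) := by
    calc |Real.log ((i : ℝ) * h i) - Real.log ((N : ℝ) * h N)|
        = |(Real.log ((i : ℝ) * h i) - Real.log L₀) - (Real.log ((N : ℝ) * h N) - Real.log L₀)| := by ring_nf
      _ ≤ |Real.log ((i : ℝ) * h i) - Real.log L₀| + |Real.log ((N : ℝ) * h N) - Real.log L₀| := abs_sub _ _
      _ < ε / (4 * C) + ε / (4 * C) := add_lt_add hdi hdN
      _ = ε / (2 * C) := by ring
  -- 0 ≤ log(i/N) ≤ ε/(2C)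
  have hiN1 : 1 ≤ (i : ℝ) / N := (one_le_div hNpos).mpr (Nat.cast_le.mpr h1)
  have hlogq0 : 0 ≤ Real.log ((i : ℝ) / N) := Real.log_nonneg hiN1
  have hlogq : Real.log ((i : ℝ) / N) ≤ ε / (2 * C) := by
    have hratio : (i : ℝ) / N ≤ Real.exp (ε / (2 * C)) := by rw [div_le_iff₀ hNpos]; exact h2
    have := Real.log_le_log (by positivity) hratio
    rwa [Real.log_exp] at this
  -- log(h_i/h_N) = (log x_i − log x_N) − log(i/N)
  have hident : Real.log (h i / h N) =
      (Real.log ((i : ℝ) * h i) - Real.log ((N : ℝ) * h N)) - Real.log ((i : ℝ) / N) := by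
    rw [Real.log_div (hpos i).ne' (hpos N).ne', Real.log_mul hipos.ne' (hpos i).ne',
      Real.log_mul hNpos.ne' (hpos N).ne', Real.log_div hipos.ne' hNpos.ne']
    ring
  have habs : |Real.log (h i / h N)| ≤ ε / C := by
    rw [hident]
    calc |Real.log ((i : ℝ) * h i) - Real.log ((N : ℝ) * h N) - Real.log ((i : ℝ) / N)|
        ≤ |Real.log ((i : ℝ) * h i) - Real.log ((N : ℝ) * h N)| + |Real.log ((i : ℝ) / N)| := abs_sub _ _
      _ ≤ ε / (2 * C) + ε / (2 * C) := add_le_add hxx.le (by rw [abs_of_nonneg hlogq0]; exact hlogq)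
      _ = ε / C := by ring
  calc |M (h i) - M (h N)| ≤ C * |Real.log (h i / h N)| :=
        logLip_abs hlip (hpos N) (hN₂ N hN2) (hpos i) (hN₂ i (hN2.trans h1))
    _ ≤ C * (ε / C) := mul_le_mul_of_nonneg_left habs hC.le
    _ = ε := by field_simp

/-! ## §3 The sampled datum is the datum: `M(h_n) → m ⟺ M → m at 0⁺` -/

/-- ABELIAN DIRECTION: `M → m` at 0⁺ and `h_n → 0⁺` ⟹ `M(h_n) → m` (composition; no log-Lipschitz bound needed). [folklore] -/
theorem tendsto_sampled_of_tendsto (hpos : ∀ n, 0 < h n) (hclock : Tendsto (fun n : ℕ => (n : ℝ) * h n) atTop (𝓝 L₀))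
    {m : ℝ} (hM : Tendsto M (𝓝[>] 0) (𝓝 m)) : Tendsto (fun n => M (h n)) atTop (𝓝 m) :=
  hM.comp (clock_nhdsWithin hpos hclock)

/-- **THE SAMPLES DECIDE THE DATUM (HEADLINE).**  Log-Lipschitz M on ]0, δ[ (C > 0), `h_n > 0`, `n·h_n → L₀ > 0` and `M(h_n) → m` ⟹
**`M(t) → m` as t → 0⁺**: every small t is clock-close to the sample n := ⌈L₀∕t⌉ — `n·t ∈ [L₀, L₀ + t]`, so with `|n·h_n − L₀| ≤ λL₀` and
`t ≤ λL₀` the ratio `h_n∕t` lies in `[(1 + λ)⁻¹(1 − λ), 1 + λ]` and `|M t − M(h_n)| ≤ C·log((1 + λ)∕(1 − λ)) ≤ 4Cλ`. [folklore] -/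
theorem tendsto_of_tendsto_sampled (hC : 0 < C) (hδ : 0 < δ)
    (hlip : ∀ t u : ℝ, 0 < t → t ≤ u → u < δ → |M u - M t| ≤ C * Real.log (u / t))
    (hpos : ∀ n, 0 < h n) (hL₀ : 0 < L₀) (hclock : Tendsto (fun n : ℕ => (n : ℝ) * h n) atTop (𝓝 L₀))
    {m : ℝ} (hsam : Tendsto (fun n => M (h n)) atTop (𝓝 m)) : Tendsto M (𝓝[>] 0) (𝓝 m) := by
  rw [Metric.tendsto_nhdsWithin_nhds]
  intro ε hε
  -- tolerance λ with 4Cλ ≤ ε/2 and λ ≤ 1/2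
  set l := min (1 / 2 : ℝ) (ε / (8 * C)) with hl
  have hl0 : 0 < l := by rw [hl]; exact lt_min (by norm_num) (by positivity)
  have hl1 : l ≤ 1 / 2 := min_le_left _ _
  have hl2 : 4 * C * l ≤ ε / 2 := by
    have : l ≤ ε / (8 * C) := min_le_right _ _
    rw [le_div_iff₀ (by positivity)] at this; linarith
  -- indices beyond which: |x_n − L₀| < λ L₀, |M(h_n) − m| < ε/2, h_n < δ
  obtain ⟨N₁, hN₁⟩ := (Metric.tendsto_atTop.mp hclock) (l * L₀) (by positivity)
  obtain ⟨N₂, hN₂⟩ := (Metric.tendsto_atTop.mp hsam) (ε / 2) (by positivity)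
  obtain ⟨N₃, hN₃⟩ := eventually_atTop.mp ((clock_tendsto_zero hclock).eventually (gt_mem_nhds hδ))
  set Nm : ℕ := max N₁ (max N₂ N₃) with hNm
  refine ⟨min (l * L₀) (min (δ / 2) (L₀ / ((Nm : ℝ) + 1))), lt_min (by positivity) (lt_min (by positivity) (by positivity)),
    fun t ht hdist => ?_⟩
  have ht0 : 0 < t := ht
  rw [dist_zero_right, Real.norm_eq_abs, abs_of_pos ht0] at hdist
  have htl : t < l * L₀ := lt_of_lt_of_le hdist (min_le_left _ _)
  have htδ : t < δ := by
    have := lt_of_lt_of_le hdist ((min_le_right _ _).trans (min_le_left _ _)); linarith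
  have htN : t < L₀ / ((Nm : ℝ) + 1) := lt_of_lt_of_le hdist ((min_le_right _ _).trans (min_le_right _ _))
  -- the sample index n := ⌈L₀/t⌉₊
  set n : ℕ := ⌈L₀ / t⌉₊ with hn
  have hnlo : L₀ / t ≤ n := Nat.le_ceil _
  have hnhi : (n : ℝ) < L₀ / t + 1 := Nat.ceil_lt_add_one (by positivity)
  have hNm_lt : (Nm : ℝ) < n := by
    have h1 : (Nm : ℝ) + 1 < L₀ / t := by
      rw [lt_div_iff₀ ht0]; rw [lt_div_iff₀ (by positivity)] at htN; linarith
    linarith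
  have hNm_le : Nm < n := Nat.cast_lt.mp hNm_lt
  have hn1 : N₁ ≤ n := le_trans (le_max_left _ _) hNm_le.le
  have hn2 : N₂ ≤ n := le_trans ((le_max_left _ _).trans (le_max_right _ _)) hNm_le.le
  have hn3 : N₃ ≤ n := le_trans ((le_max_right _ _).trans (le_max_right _ _)) hNm_le.le
  have hnpos : 0 < (n : ℝ) := lt_of_le_of_lt (Nat.cast_nonneg Nm) hNm_lt
  -- n t ∈ [L₀, (1 + λ)L₀]
  have hnt_lo : L₀ ≤ (n : ℝ) * t := by rw [div_le_iff₀ ht0] at hnlo; exact hnlo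
  have hnt_hi : (n : ℝ) * t ≤ (1 + l) * L₀ := by
    have : (n : ℝ) * t < L₀ + t := by
      have := mul_lt_mul_of_pos_right hnhi ht0
      rwa [add_mul, div_mul_cancel₀ _ ht0.ne', one_mul] at this
    nlinarith
  -- x_n ∈ [(1 − λ)L₀, (1 + λ)L₀]
  have hx := hN₁ n hn1
  rw [Real.dist_eq] at hx
  have hx_lo : (1 - l) * L₀ ≤ (n : ℝ) * h n := by have := (abs_lt.mp hx).1; linarith
  have hx_hi : (n : ℝ) * h n ≤ (1 + l) * L₀ := by have := (abs_lt.mp hx).2; linarith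
  -- the ratio h_n / t = x_n / (n t) lies in [ρ⁻¹, ρ], ρ = (1+λ)/(1−λ)
  have h1l : 0 < 1 - l := by linarith
  set ρ := (1 + l) / (1 - l) with hρ
  have hρ1 : 1 ≤ ρ := by rw [hρ, le_div_iff₀ h1l]; linarith
  have hratio_eq : h n / t = ((n : ℝ) * h n) / ((n : ℝ) * t) := by
    rw [mul_div_mul_left _ _ hnpos.ne']
  have hnt_pos : 0 < (n : ℝ) * t := by positivity
  have hr_hi : h n / t ≤ ρ := by
    rw [hratio_eq, div_le_iff₀ hnt_pos]
    calc (n : ℝ) * h n ≤ (1 + l) * L₀ := hx_hi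
      _ ≤ ρ * L₀ := by
          apply mul_le_mul_of_nonneg_right _ hL₀.le
          rw [hρ, le_div_iff₀ h1l]; nlinarith
      _ ≤ ρ * ((n : ℝ) * t) := mul_le_mul_of_nonneg_left hnt_lo (by linarith)
  have hr_lo : ρ⁻¹ ≤ h n / t := by
    rw [hratio_eq, hρ, inv_div, div_le_div_iff₀ (by linarith) hnt_pos]
    calc (1 - l) * ((n : ℝ) * t) ≤ (1 - l) * ((1 + l) * L₀) := mul_le_mul_of_nonneg_left hnt_hi h1l.le
      _ = (1 - l) * L₀ * (1 + l) := by ring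
      _ ≤ (n : ℝ) * h n * (1 + l) := mul_le_mul_of_nonneg_right hx_lo (by linarith)
  have hlogratio : |Real.log (h n / t)| ≤ 4 * l :=
    (abs_log_le_of_bounds (div_pos (hpos n) ht0) hρ1 hr_lo hr_hi).trans (log_ratio_le_four_mul hl0.le hl1)
  -- conclude
  have hnear : |M (h n) - M t| ≤ ε / 2 :=
    calc |M (h n) - M t| ≤ C * |Real.log (h n / t)| := logLip_abs hlip ht0 htδ (hpos n) (hN₃ n hn3)
      _ ≤ C * (4 * l) := mul_le_mul_of_nonneg_left hlogratio hC.le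
      _ ≤ ε / 2 := by linarith
  have hsm := hN₂ n hn2
  rw [Real.dist_eq] at hsm ⊢
  calc |M t - m| = |(M (h n) - m) - (M (h n) - M t)| := by ring_nf
    _ ≤ |M (h n) - m| + |M (h n) - M t| := abs_sub _ _
    _ < ε / 2 + ε / 2 := add_lt_add_of_lt_of_le hsm hnear
    _ = ε := by ring

/-- **`M(h_n) → m ⟺ M → m at 0⁺`** under the two-loop clock and the log-Lipschitz bound — the cutoff couplings sample the three-loop datum
faithfully. [folklore] -/
theorem tendsto_sampled_iff (hC : 0 < C) (hδ : 0 < δ)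
    (hlip : ∀ t u : ℝ, 0 < t → t ≤ u → u < δ → |M u - M t| ≤ C * Real.log (u / t))
    (hpos : ∀ n, 0 < h n) (hL₀ : 0 < L₀) (hclock : Tendsto (fun n : ℕ => (n : ℝ) * h n) atTop (𝓝 L₀)) (m : ℝ) :
    Tendsto (fun n => M (h n)) atTop (𝓝 m) ↔ Tendsto M (𝓝[>] 0) (𝓝 m) :=
  ⟨tendsto_of_tendsto_sampled hC hδ hlip hpos hL₀ hclock, tendsto_sampled_of_tendsto hpos hclock⟩

/-! ## §4 The cutoff average of the deviation cannot create its limit -/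

/-- The deviation's principal part `u_n = c·(M(h_n) − m)` is slowly oscillating at ∞ (scale §2 by |c|). [folklore] -/
theorem deviation_slowlyOscillating (hC : 0 < C) (hδ : 0 < δ)
    (hlip : ∀ t u : ℝ, 0 < t → t ≤ u → u < δ → |M u - M t| ≤ C * Real.log (u / t))
    (hpos : ∀ n, 0 < h n) (hL₀ : 0 < L₀) (hclock : Tendsto (fun n : ℕ => (n : ℝ) * h n) atTop (𝓝 L₀)) (c m : ℝ) :
    ∀ ε > 0, ∃ q > (1:ℝ), ∃ N₀ : ℕ, ∀ N i : ℕ, N₀ ≤ N → N ≤ i → (i : ℝ) ≤ q * N →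
      |c * (M (h i) - m) - c * (M (h N) - m)| ≤ ε := by
  intro ε hε
  obtain ⟨q, hq, N₀, hso⟩ := sampled_slowlyOscillating hC hδ hlip hpos hL₀ hclock (ε / (|c| + 1)) (by positivity)
  refine ⟨q, hq, N₀, fun N i h0 h1 h2 => ?_⟩
  have hwin := hso N i h0 h1 h2
  have hc1 : 0 < |c| + 1 := by positivity
  calc |c * (M (h i) - m) - c * (M (h N) - m)| = |c| * |M (h i) - M (h N)| := by
        rw [← abs_mul]; ring_nf
    _ ≤ (|c| + 1) * (ε / (|c| + 1)) := mul_le_mul (by linarith) hwin (abs_nonneg _) hc1.le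
    _ = ε := by field_simp

/-- **END — AVERAGING THE BARE 1∕K LETTER DEVIATION OVER CUTOFFS CANNOT CREATE THE LETTER.**  Let M be C-log-Lipschitz on ]0, δ[ (C, δ > 0),
`h_n > 0` with the two-loop clock `n·h_n → L₀ > 0`, `e_n → 0`, `c ≠ 0`, and `d_n := c·(M(h_n) − m) + e_n` (the shape of row L120's 1∕K letter
deviation along the bare couplings, c = 1∕β₀², M = the three-loop Cesàro mean, m = β₀²b).  Then:
**(i) `N⁻¹·Σ_{n<N} d_n → 0 ⟺ d_n → 0`;  (ii) `d_n → 0 ⟺ M(h_n) → m`;  (iii) `M(h_n) → m ⟺ M → m at 0⁺`** — the cutoff-averaged deviation, the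
deviation, the sampled datum and the three-loop Cesàro datum are ONE datum (Schmidt's theorem for sequences, P2 #53a, on the slowly
oscillating principal part; §3).  The bare ∕ cutoff twin of row L130 (RG-time average of the running coupling's letter deviation). [folklore] -/
theorem cutoffAverage_iff (hC : 0 < C) (hδ : 0 < δ)
    (hlip : ∀ t u : ℝ, 0 < t → t ≤ u → u < δ → |M u - M t| ≤ C * Real.log (u / t))
    (hpos : ∀ n, 0 < h n) (hL₀ : 0 < L₀) (hclock : Tendsto (fun n : ℕ => (n : ℝ) * h n) atTop (𝓝 L₀))
    (he : Tendsto e atTop (𝓝 0)) {c : ℝ} (hc : c ≠ 0) (m : ℝ) :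
    (Tendsto (fun N : ℕ => (N : ℝ)⁻¹ * ∑ n ∈ range N, (c * (M (h n) - m) + e n)) atTop (𝓝 0) ↔
        Tendsto (fun n => c * (M (h n) - m) + e n) atTop (𝓝 0)) ∧
      (Tendsto (fun n => c * (M (h n) - m) + e n) atTop (𝓝 0) ↔ Tendsto (fun n => M (h n)) atTop (𝓝 m)) ∧
      (Tendsto (fun n => M (h n)) atTop (𝓝 m) ↔ Tendsto M (𝓝[>] 0) (𝓝 m)) := by
  obtain ⟨h1, h2⟩ := cesaro_add_null_iff (u := fun n => c * (M (h n) - m)) (e := e)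
    (deviation_slowlyOscillating hC hδ hlip hpos hL₀ hclock c m) he 0
  refine ⟨h1, h2.trans ⟨fun hu => ?_, fun hs => ?_⟩, tendsto_sampled_iff hC hδ hlip hpos hL₀ hclock m⟩
  · -- c·(M(h_n) − m) → 0 ⟹ M(h_n) → m
    have := hu.const_mul c⁻¹
    rw [mul_zero] at this
    have h' : Tendsto (fun n => M (h n) - m) atTop (𝓝 0) := by
      refine this.congr fun n => ?_
      show c⁻¹ * (c * (M (h n) - m)) = M (h n) - m
      rw [← mul_assoc, inv_mul_cancel₀ hc, one_mul]
    have h'' := h'.add_const m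
    simpa using h''
  · have h' : Tendsto (fun n => M (h n) - m) atTop (𝓝 0) := by
      have := hs.sub_const m; simpa using this
    have := h'.const_mul c
    rwa [mul_zero] at this

end

end Summit.QuantumFields.BalabanUV.Beta.EriceFlowEnclosureCesaroClockSampling
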